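import Summits.HodgeConjecture.HodgeConjecture.Theses.HeckeOrbitCompactness
import HarnessLib

/-!
# Route `HeckeOrbitCompactness`, crux `OrbitDegreeBound` (stmt-HodgeConjecture-13689):
# the K-SATURATION SPLIT `OrbitWeilSeed → OrbitKTransport → WeilLinesRankOne → OrbitDegreeBound`

Definition-free file: the crux-strategist's PROVED assembly of the BC2 redirect of the route's
deciding crux (2026-08-17, `Cruxes/OrbitDegreeBound/Lines/KSaturationSplit.lean`, reproduced verbatim
below), followed by the support item `OrbitDegreeBoundOfSubs` (stmt-HodgeConjecture-17832) it closes
(`heckeOrbitCompactness_orbitDegreeBoundOfSubs_proof`, last section). The rank-2 crux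
`OrbitDegreeBound` (X) asks for ONE integer `M(n, d, t, t')` such that at EVERY abelian `2n`-fold `A`
of the `K = ℚ(√-d)`-isogeny orbit of the split squares `B₀ × B₀` (typed by `g : B₀ × B₀ ⟶ A`,
`g*P ~ N·Θ₀`), EVERY rational class of the Weil plane `W(A, φ) = E₊ ⊔ E₋` lies in the span
`SUPP_M(A, P)` of the classes supported on proper intersections `D₁ ∩ … ∩ Dₙ` of effective
`Dᵢ ∈ |kᵢ P|`, `kᵢ ≤ M`. The split cuts X along the action of the order `ℕ[φ] ⊆ End A` on
cohomology (van Geemen, LNM 1594, 4.8–4.9; Deligne–Milne, LNM 900, §4):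

* `OrbitWeilSeed` (P1, crux): the same uniform `M`, but only ONE class `c ∈ W(A, φ) ∩ SUPP_M(A, P)`
  off the two eigen-lines (`c ∉ E₊`, `c ∉ E₋`) at every orbit point — no rationality, no Hodge type;
* `OrbitKTransport` (P2, crux): pull-back along `x·𝟙 + y·φ` carries `SUPP_M` into `SUPP_{M'}`,
  `M'(n, d, t, t', x, y, M)` uniform along the orbit (Rosati: `(x + yφ)^*P ≡ (x² + dy²)·P`);
* `WeilLinesRankOne` (P3, support): for `dim A = 2n`, `φ ≫ φ = -d`, the eigen-spaces `E₊`, `E₋` of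
  the characters `(x ± iy√d)^{2n}` have rank ≤ 1 (they are the lines `⋀^{2n} V±`; van Geemen, proof
  of Thm. 6.12; Deligne–Milne (4.4)).

Proof of the assembly (`OrbitDegreeBound_of_subs`, kernel-checked, no new definition): choose
`x ∈ ℕ` with `λ₊ = (x + i√d)^{2n} ≠ (x - i√d)^{2n} = λ₋` (`eq_zero_of_forall_natCast_add_pow_eq` of
`HodgeTheory/WeilClasses`: the two characters cannot agree on all of `ℕ` since `i√d ≠ 0`); take
`M` from P1 and `M'` from P2 at `(x, 1, M)` and answer X with `max M M'`. At an orbit point let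
`c₀ = a + b` be the seed (`a ∈ E₊`, `b ∈ E₋`; both non-zero because `c₀` is off the lines). By the
eigen-conditions `(x·𝟙 + 1·φ)^* c₀ = λ₊ a + λ₋ b`, which lies in `SUPP_{M'}` (P2), while
`c₀ ∈ SUPP_M`; `SUPP` is monotone in the bound (`suppSpan_mono`), so the 2 × 2 system inverts inside
`SUPP_{max M M'}`: `a = (λ₊ - λ₋)⁻¹ ((x + φ)^* c₀ - λ₋ c₀)` and symmetrically `b` lie there. By P3
every class of `W = E₊ ⊔ E₋ = ℂ a ⊕ ℂ b` does — in particular every rational Weil class: X.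

References: [vanGeemen1994HodgeAV] B. van Geemen, LNM 1594 (1994), 4.8–4.11, Lemma 5.2, proof of
Thm. 6.12; [Deligne1982HodgeCycles] P. Deligne (notes by J. Milne), LNM 900 (1982), §4 (4.3)–(4.4),
Thm. 4.8; [LangeBirkenhake1992] §5.1 (Rosati involution), for P2's bookkeeping.
-/

noncomputable section

-- `Summit.<Summit>.<Problem>` is the tree's mandated summit-side namespace (CONVENTIONS §2); deliberate duplicate.
set_option linter.dupNamespace false

namespace Summit.HodgeConjecture.HodgeConjecture.Theorems.OrbitDegreeBound

open CategoryTheory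
open Literature.AlgebraicGeometry Literature.AlgebraicGeometry.Motives
open Literature.AlgebraicGeometry.HodgeTheory
open Literature.AlgebraicTopology.SingularHomology
open Summit.HodgeConjecture.HodgeConjecture.Theses.HeckeOrbitCompactness (OrbitDegreeBound)

/-- `SUPP_M(A, P) ≤ SUPP_{M'}(A, P)` for `M ≤ M'`: an admissible `M`-bounded tuple of effective
divisors `Dᵢ ~ kᵢ P`, `kᵢ ≤ M`, with proper total intersection is an admissible `M'`-bounded tuple.
[folklore] -/
theorem suppSpan_mono {n : ℕ} {A : AbelianVariety ℂ} (P : CartierDivisor A.X.left) {M M' : ℕ}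
    (h : M ≤ M') :
    (⨆ (D : Fin n → CartierDivisor A.X.left)
        (_ : ∀ i, (D i).IsSection 1 ∧ ∃ k : ℕ, k ≤ M ∧ (D i).LinEquiv (k • P))
        (_ : ∀ z ∈ {z | ∀ i, ¬ (D i).Avoids z}, ((n : ℕ) : ℕ∞) ≤ Order.coheight z),
        LinearMap.ker (complexBetti.restrictCompl A.X {z | ∀ i, ¬ (D i).Avoids z} (2 * n)).hom) ≤
      ⨆ (D : Fin n → CartierDivisor A.X.left)
        (_ : ∀ i, (D i).IsSection 1 ∧ ∃ k : ℕ, k ≤ M' ∧ (D i).LinEquiv (k • P))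
        (_ : ∀ z ∈ {z | ∀ i, ¬ (D i).Avoids z}, ((n : ℕ) : ℕ∞) ≤ Order.coheight z),
        LinearMap.ker (complexBetti.restrictCompl A.X {z | ∀ i, ¬ (D i).Avoids z} (2 * n)).hom := by
  refine iSup_le fun D => iSup_le fun hD => iSup_le fun hZ => ?_
  have hD' : ∀ i, (D i).IsSection 1 ∧ ∃ k : ℕ, k ≤ M' ∧ (D i).LinEquiv (k • P) := fun i =>
    ⟨(hD i).1, by obtain ⟨k, hk, hkD⟩ := (hD i).2; exact ⟨k, hk.trans h, hkD⟩⟩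
  exact le_iSup_of_le D (le_iSup_of_le hD' (le_iSup_of_le hZ le_rfl))

/-- For `n ≥ 1`, `d ≥ 1` some natural number `x` separates the two Weil characters at `y = 1`:
`(x + i√d)^{2n} ≠ (x - i√d)^{2n}` (else `i√d = 0`, `eq_zero_of_forall_natCast_add_pow_eq`).
[cite: vanGeemen1994HodgeAV, proof of Thm. 6.12] -/
theorem exists_nat_weilCharacters_ne {n d : ℕ} (hn : 1 ≤ n) (hd : 0 < d) :
    ∃ x : ℕ, ((x : ℂ) + ((1 : ℕ) : ℂ) * Complex.I * (Real.sqrt d : ℂ)) ^ (2 * n) ≠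
      ((x : ℂ) - ((1 : ℕ) : ℂ) * Complex.I * (Real.sqrt d : ℂ)) ^ (2 * n) := by
  by_contra h
  have hsq : (Real.sqrt d : ℂ) ≠ 0 := by
    rw [Ne, Complex.ofReal_eq_zero]
    exact (Real.sqrt_pos.mpr (by exact_mod_cast hd)).ne'
  have ha : ((1 : ℕ) : ℂ) * Complex.I * (Real.sqrt d : ℂ) ≠ 0 :=
    mul_ne_zero (mul_ne_zero (by norm_num) Complex.I_ne_zero) hsq
  refine ha (eq_zero_of_forall_natCast_add_pow_eq (m := 2 * n) (by omega) fun x => ?_)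
  by_contra hx
  exact h ⟨x, hx⟩

/-- **The K-saturation split of `OrbitDegreeBound`** (BC2 redirect of the RESTATED deciding crux of
route `HeckeOrbitCompactness`): one bounded Weil seed off the eigen-lines at every orbit point
(`OrbitWeilSeed`), bounded-loss transport of `P`-complexity along `x·𝟙 + y·φ` (`OrbitKTransport`)
and the rank-one property of the Weil eigen-lines (`WeilLinesRankOne`) imply the uniform orbit
degree bound for all rational Weil classes. The three hypotheses are the route's child items by name
(split of stmt-HodgeConjecture-13689), unfolded at the start of the proof. [cite: vanGeemen1994HodgeAV, 4.8–4.9 and proof of Thm. 6.12]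
[cite: Deligne1982HodgeCycles, §4 (4.3)–(4.4)] -/
theorem OrbitDegreeBound_of_subs
    (hS : Summit.HodgeConjecture.HodgeConjecture.Theses.HeckeOrbitCompactness.OrbitWeilSeed)
    (hT : Summit.HodgeConjecture.HodgeConjecture.Theses.HeckeOrbitCompactness.OrbitKTransport)
    (hL : Summit.HodgeConjecture.HodgeConjecture.Theses.HeckeOrbitCompactness.WeilLinesRankOne) :
    OrbitDegreeBound := by
  unfold Summit.HodgeConjecture.HodgeConjecture.Theses.HeckeOrbitCompactness.OrbitWeilSeed at hS
  unfold Summit.HodgeConjecture.HodgeConjecture.Theses.HeckeOrbitCompactness.OrbitKTransport at hT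
  unfold Summit.HodgeConjecture.HodgeConjecture.Theses.HeckeOrbitCompactness.WeilLinesRankOne at hL
  intro n d t t' hn hd
  -- a natural number separating the two Weil characters at `y = 1`
  obtain ⟨x, hx⟩ := exists_nat_weilCharacters_ne (n := n) (d := d) hn hd
  obtain ⟨M, hM⟩ := hS n d t t' hn hd
  obtain ⟨M', hM'⟩ := hT n d t t' x 1 M hn hd
  refine ⟨max M M', ?_⟩
  intro B₀ PB _ _ hB hPBa hPBs hPBt A g φ P N _ hg hA hsp hN hcomm hφ hPa hPs hPt hlin c _ hcW
  -- the seed at this orbit point and its transport along `x·𝟙 + 1·φ`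
  obtain ⟨c₀, hc₀W, hc₀p, hc₀m, hc₀S⟩ :=
    hM B₀ PB hB hPBa hPBs hPBt A g φ P N hg hA hsp hN hcomm hφ hPa hPs hPt hlin
  have hTc₀ := hM' B₀ PB hB hPBa hPBs hPBt A g φ P N hg hA hsp hN hcomm hφ hPa hPs hPt hlin c₀ hc₀S
  have hc₀S' := suppSpan_mono (n := n) P (le_max_left M M') hc₀S
  have hTc₀' := suppSpan_mono (n := n) P (le_max_right M M') hTc₀
  -- decompose the seed along `W = E₊ ⊔ E₋`
  rw [weilClassesOf, Submodule.mem_sup] at hc₀W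
  obtain ⟨a, ha, b, hb, hab⟩ := hc₀W
  have ea := (mem_weilClassesPlus_iff.mp ha) x 1
  have eb := (mem_weilClassesMinus_iff.mp hb) x 1
  have ha0 : a ≠ 0 := by
    rintro rfl
    apply hc₀m
    rw [← hab, zero_add]
    exact hb
  have hb0 : b ≠ 0 := by
    rintro rfl
    apply hc₀p
    rw [← hab, add_zero]
    exact ha
  -- the transported seed is `λ₊ a + λ₋ b`
  have hF : singularCohomology.map ℂ ℂ
      (AlgPoints.mapContinuous (L := ℂ) (x • 𝟙 A + (1 : ℕ) • φ).hom.hom.hom) (2 * n) c₀ =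
      ((x : ℂ) + ((1 : ℕ) : ℂ) * Complex.I * (Real.sqrt d : ℂ)) ^ (2 * n) • a +
        ((x : ℂ) - ((1 : ℕ) : ℂ) * Complex.I * (Real.sqrt d : ℂ)) ^ (2 * n) • b := by
    rw [← hab, map_add, ea, eb]
  -- invert the 2 × 2 system inside `SUPP_{max M M'}`
  set lp : ℂ := ((x : ℂ) + ((1 : ℕ) : ℂ) * Complex.I * (Real.sqrt d : ℂ)) ^ (2 * n) with hlp
  set lm : ℂ := ((x : ℂ) - ((1 : ℕ) : ℂ) * Complex.I * (Real.sqrt d : ℂ)) ^ (2 * n) with hlm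
  have h1 : (lp - lm) • a = singularCohomology.map ℂ ℂ
      (AlgPoints.mapContinuous (L := ℂ) (x • 𝟙 A + (1 : ℕ) • φ).hom.hom.hom) (2 * n) c₀ - lm • c₀ := by
    rw [hF, ← hab, smul_add, sub_smul]
    abel
  have h2 : (lm - lp) • b = singularCohomology.map ℂ ℂ
      (AlgPoints.mapContinuous (L := ℂ) (x • 𝟙 A + (1 : ℕ) • φ).hom.hom.hom) (2 * n) c₀ - lp • c₀ := by
    rw [hF, ← hab, smul_add, sub_smul]
    abel
  have hpm : lp - lm ≠ 0 := sub_ne_zero.mpr hx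
  have hmp : lm - lp ≠ 0 := sub_ne_zero.mpr (Ne.symm hx)
  have ha_eq : a = (lp - lm)⁻¹ • (singularCohomology.map ℂ ℂ
      (AlgPoints.mapContinuous (L := ℂ) (x • 𝟙 A + (1 : ℕ) • φ).hom.hom.hom) (2 * n) c₀ - lm • c₀) := by
    rw [← h1, smul_smul, inv_mul_cancel₀ hpm, one_smul]
  have hb_eq : b = (lm - lp)⁻¹ • (singularCohomology.map ℂ ℂ
      (AlgPoints.mapContinuous (L := ℂ) (x • 𝟙 A + (1 : ℕ) • φ).hom.hom.hom) (2 * n) c₀ - lp • c₀) := by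
    rw [← h2, smul_smul, inv_mul_cancel₀ hmp, one_smul]
  -- every class of `W = ℂ a ⊕ ℂ b` is then in `SUPP_{max M M'}`
  obtain ⟨hLp, hLm⟩ := hL n d hn hd A φ hA hsp hφ
  rw [weilClassesOf, Submodule.mem_sup] at hcW
  obtain ⟨a', ha', b', hb', rfl⟩ := hcW
  obtain ⟨μ, rfl⟩ := hLp a ha ha0 a' ha'
  obtain ⟨ν, rfl⟩ := hLm b hb hb0 b' hb'
  refine add_mem (Submodule.smul_mem _ μ ?_) (Submodule.smul_mem _ ν ?_)
  · rw [ha_eq]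
    exact Submodule.smul_mem _ _ (sub_mem hTc₀' (Submodule.smul_mem _ _ hc₀S'))
  · rw [hb_eq]
    exact Submodule.smul_mem _ _ (sub_mem hTc₀' (Submodule.smul_mem _ _ hc₀S'))

end Summit.HodgeConjecture.HodgeConjecture.Theorems.OrbitDegreeBound

namespace Summit.HodgeConjecture.HodgeConjecture.Theorems

/-- **Support item `OrbitDegreeBoundOfSubs` of route `HeckeOrbitCompactness`
(stmt-HodgeConjecture-17832): `OrbitWeilSeed → OrbitKTransport → WeilLinesRankOne → OrbitDegreeBound`**,
the K-saturation split of the deciding crux, by `OrbitDegreeBound.OrbitDegreeBound_of_subs` (whose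
three hypotheses are the three child items, verbatim). [cite: vanGeemen1994HodgeAV, 4.8–4.9 and proof of Thm. 6.12]
[cite: Deligne1982HodgeCycles, §4 (4.3)–(4.4)] -/
theorem heckeOrbitCompactness_orbitDegreeBoundOfSubs_proof :
    Summit.HodgeConjecture.HodgeConjecture.Theses.HeckeOrbitCompactness.OrbitDegreeBoundOfSubs :=
  fun h₁ h₂ h₃ ↦ OrbitDegreeBound.OrbitDegreeBound_of_subs h₁ h₂ h₃

end Summit.HodgeConjecture.HodgeConjecture.Theorems

end
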